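import Summits.HodgeConjecture.CorCM.Model.ProductCMAction
import Summits.HodgeConjecture.CorCM.Model.RosatiDualForm
import Summits.HodgeConjecture.CorCM.Model.DiagonalDegree
import Literature.AlgebraicGeometry.ComplexMultiplication.RosatiPolarizationCM
import HarnessLib

/-!
# COR-CM model layer, row M22 input R2 (part B): a Rosati-compatible algebraic polarisation class on a four-fold
# product of abelian varieties with factorwise CM data, in Betti dual form

Cell `pub-hodgecm2` (COR-CM = Hodge ladder stage 2), binder row M22 `Fact_algDuality` (Lieberman / Fourier duality
of the corner product), input **R2** — "a polarisation whose Rosati involution induces complex conjugation on `K`"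
(Shimura 1998 §6.2 Thm. 4; Milne, CM, Ex. 2.9; Deligne LNM 900 §4 p. 47) — for the DIAGONAL action of `K` on
`H¹(B; ℚ) = ⊕ᵢ H¹(Aᵢ; ℚ)` of a left-nested product `B = ((A₀ × A₁) × A₂) × A₃` of complex abelian varieties
(`AbelianVariety.prod`), seat b26.  The model instance (coded realisations of the Picard–CM universe) is the file
`CorCM/Model/RosatiThetaProduct`.  HONEST FRAMING: no case of the Hodge conjecture is proved here; the only
algebraicity used is Lefschetz (1,1) inside the tree theorem `ComplexMultiplication.exists_rosati_ratClass_of_eigenbasis`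
(lit-milne, p232481).

* `exists_diagData_prod4` — for four abelian varieties carrying endomorphisms `uᵢ : 𝓞_K → End(Aᵢ)` diagonal on bases
  of `H¹(Aᵢ(ℂ); ℂ)` and inducing `ℚ`-algebra actions `ι'ᵢ` on `H¹(Aᵢ(ℂ); ℚ)`: the diagonal endomorphisms `u(b)` of
  `B` (`AbelianVariety.prodLift`), an eigenbasis of `H¹(B(ℂ); ℂ)` for them, and a `ℚ`-algebra action `ι` of `K` on
  `H¹(B(ℂ); ℚ)` with `u(b)^* = ι(b)` and `ι(a) ∘ prᵢ^* = prᵢ^* ∘ ι'ᵢ(a)` for the four composite projections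
  (three applications of `exists_eigenbasis_prod` / `exists_ratAction_prod` of `CorCM/Model/ProductCMAction`);
* `rosatiTheta_prod4` — **R2 on `B`**: there is `θ ∈ H²(B(ℂ); ℚ)`, rational-algebraic, with `θ ⊗ 1` a non-zero real
  multiple of a Kähler class and `(θ ⊗ 1)^{dim B} ≠ 0`, such that for every `a ∈ K` and all `ℚ`-linear `T, T'` on
  `H¹(B(ℂ); ℚ)` acting diagonally by `a`, resp. `ā` (`T ∘ prᵢ^* = prᵢ^* ∘ ι'ᵢ(a)`, `T' ∘ prᵢ^* = prᵢ^* ∘ ι'ᵢ(ā)`;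
  e.g. `T = Ma^*`, `T' = Mb^*` for the package's `IsDiagAct a Ma`, `IsDiagAct ā Mb`),
  `B_θ(φ ∘ T, ψ) = B_θ(φ, ψ ∘ T')` for all covectors `φ, ψ`, where
  `B_θ(φ, ψ) = exteriorPower.alternatingMapToDual ℚ _ 2 ![φ, ψ] ω`, `wedgeToCup ω = θ` (on `θ = x ∪ y`:
  `φ(x)ψ(y) - ψ(x)φ(y) = (φ ⊗ ψ)(x ⊗ y - y ⊗ x)`, the evaluation of the K-a tensor `Σ_a b_a ⊗ y_a`, `y` the
  `θ`-polar basis).  Proof: `exists_rosati_ratClass_of_eigenbasis` ON `B` (hyperplane class of `B` averaged over the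
  diagonal `𝓞_K`-action), its `K`-balanced clause descended to `H²(B(ℂ); ℚ)` (`ofRatClass_injective`),
  `bettiDual_rosati_of_balanced_endo` (file `RosatiDualForm`), and the Künneth junction `T = ι(a)`
  (`kunneth_one_bijective₄`, `LinearMap.cancel_right`).

## References
* [Shimura1998] G. Shimura, *Abelian Varieties with Complex Multiplication and Modular Functions* (1998), §6.2
  Thm. 4 (3).
* [MilneCM2006] J. S. Milne, *Complex Multiplication* (2006), Ch. I Example 2.9, Prop. 3.17.
* [Deligne1982HodgeCycles] P. Deligne (notes by J. S. Milne), *Hodge cycles on abelian varieties*, LNM 900 (1982),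
  §4 p. 47, §5 Prop. 5.1 and p. 39.
* [HatcherAT2002] A. Hatcher, *Algebraic Topology* (2002), §3.2 Thm. 3.15.
-/

noncomputable section

open CategoryTheory MonoidalCategory CartesianMonoidalCategory
open Literature.AlgebraicTopology.SingularHomology
open Literature.AlgebraicGeometry Literature.AlgebraicGeometry.Motives Literature.AlgebraicGeometry.HodgeTheory
open Literature.AlgebraicGeometry.ComplexMultiplication
open Literature.NumberTheory.Automorphic.PicardCM
open NumberField

namespace Summit.HodgeConjecture.CorCM.Model

/-! ### §1 Four factors: the diagonal data on the left-nested product -/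

section Four

variable {K : Type} [Field K] [NumberField K]

/-- **Diagonal data on `B = ((A₀ × A₁) × A₂) × A₃`.**  Given, on each factor, endomorphisms `uᵢ : 𝓞_K → End(Aᵢ)`
diagonal on a basis `bᵢ` of `H¹(Aᵢ(ℂ); ℂ)` (eigencharacters `τᵢ`) and inducing a `ℚ`-algebra action `ιᵢ` on
`H¹(Aᵢ(ℂ); ℚ)`, there are: diagonal endomorphisms `u(b)` of `B`, a basis of `H¹(B(ℂ); ℂ)` on which every `u(b)^*`
is diagonal with eigencharacters among the `τᵢ`, and a `ℚ`-algebra action `ι` of `K` on `H¹(B(ℂ); ℚ)` with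
`u(b)^* = ι(b)` and `ι(a) ∘ prᵢ^* = prᵢ^* ∘ ιᵢ(a)` for the four composite projections
`pr₀ = fst ≫ fst ≫ fst`, `pr₁ = fst ≫ fst ≫ snd`, `pr₂ = fst ≫ snd`, `pr₃ = snd`.
[cite: Shimura1998, §6.2 Thm. 4] [cite: HatcherAT2002, §3.2 Thm. 3.15] -/
theorem exists_diagData_prod4 {ι₀ ι₁ ι₂ ι₃ : Type} (A₀ A₁ A₂ A₃ : AbelianVariety ℂ)
    (u₀ : 𝓞 K → (A₀ ⟶ A₀)) (u₁ : 𝓞 K → (A₁ ⟶ A₁)) (u₂ : 𝓞 K → (A₂ ⟶ A₂)) (u₃ : 𝓞 K → (A₃ ⟶ A₃))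
    (b₀ : Module.Basis ι₀ ℂ (complexBetti A₀.X 1)) (b₁ : Module.Basis ι₁ ℂ (complexBetti A₁.X 1))
    (b₂ : Module.Basis ι₂ ℂ (complexBetti A₂.X 1)) (b₃ : Module.Basis ι₃ ℂ (complexBetti A₃.X 1))
    (τ₀ : ι₀ → (K →+* ℂ)) (τ₁ : ι₁ → (K →+* ℂ)) (τ₂ : ι₂ → (K →+* ℂ)) (τ₃ : ι₃ → (K →+* ℂ))
    (hb₀ : ∀ (a : 𝓞 K) i, complexBetti.map (u₀ a).hom.hom.hom 1 (b₀ i) = (τ₀ i (a : K)) • b₀ i)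
    (hb₁ : ∀ (a : 𝓞 K) i, complexBetti.map (u₁ a).hom.hom.hom 1 (b₁ i) = (τ₁ i (a : K)) • b₁ i)
    (hb₂ : ∀ (a : 𝓞 K) i, complexBetti.map (u₂ a).hom.hom.hom 1 (b₂ i) = (τ₂ i (a : K)) • b₂ i)
    (hb₃ : ∀ (a : 𝓞 K) i, complexBetti.map (u₃ a).hom.hom.hom 1 (b₃ i) = (τ₃ i (a : K)) • b₃ i)
    (ι'₀ : K →ₐ[ℚ] Module.End ℚ (bettiCohomology A₀.X 1)) (ι'₁ : K →ₐ[ℚ] Module.End ℚ (bettiCohomology A₁.X 1))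
    (ι'₂ : K →ₐ[ℚ] Module.End ℚ (bettiCohomology A₂.X 1)) (ι'₃ : K →ₐ[ℚ] Module.End ℚ (bettiCohomology A₃.X 1))
    (hu₀ : ∀ b : 𝓞 K, BettiUniverse.pull (u₀ b).hom.hom.hom 1 = ι'₀ (b : K))
    (hu₁ : ∀ b : 𝓞 K, BettiUniverse.pull (u₁ b).hom.hom.hom 1 = ι'₁ (b : K))
    (hu₂ : ∀ b : 𝓞 K, BettiUniverse.pull (u₂ b).hom.hom.hom 1 = ι'₂ (b : K))
    (hu₃ : ∀ b : 𝓞 K, BettiUniverse.pull (u₃ b).hom.hom.hom 1 = ι'₃ (b : K)) :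
    ∃ (u : 𝓞 K → (((A₀.prod A₁).prod A₂).prod A₃ ⟶ ((A₀.prod A₁).prod A₂).prod A₃))
      (b : Module.Basis (((ι₀ ⊕ ι₁) ⊕ ι₂) ⊕ ι₃) ℂ (complexBetti (((A₀.prod A₁).prod A₂).prod A₃).X 1))
      (τ : (((ι₀ ⊕ ι₁) ⊕ ι₂) ⊕ ι₃) → (K →+* ℂ))
      (ι : K →ₐ[ℚ] Module.End ℚ (bettiCohomology (((A₀.X ⊗ A₁.X) ⊗ A₂.X) ⊗ A₃.X) 1)),
      (∀ (a : 𝓞 K) i, complexBetti.map (u a).hom.hom.hom 1 (b i) = (τ i (a : K)) • b i) ∧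
      (∀ b' : 𝓞 K, BettiUniverse.pull (u b').hom.hom.hom 1 = ι (b' : K)) ∧
      (∀ a : K, ι a ∘ₗ BettiUniverse.pull (fst ((A₀.X ⊗ A₁.X) ⊗ A₂.X) A₃.X ≫ (fst (A₀.X ⊗ A₁.X) A₂.X ≫
          fst A₀.X A₁.X)) 1 =
        BettiUniverse.pull (fst ((A₀.X ⊗ A₁.X) ⊗ A₂.X) A₃.X ≫ (fst (A₀.X ⊗ A₁.X) A₂.X ≫ fst A₀.X A₁.X)) 1 ∘ₗ
          ι'₀ a) ∧
      (∀ a : K, ι a ∘ₗ BettiUniverse.pull (fst ((A₀.X ⊗ A₁.X) ⊗ A₂.X) A₃.X ≫ (fst (A₀.X ⊗ A₁.X) A₂.X ≫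
          snd A₀.X A₁.X)) 1 =
        BettiUniverse.pull (fst ((A₀.X ⊗ A₁.X) ⊗ A₂.X) A₃.X ≫ (fst (A₀.X ⊗ A₁.X) A₂.X ≫ snd A₀.X A₁.X)) 1 ∘ₗ
          ι'₁ a) ∧
      (∀ a : K, ι a ∘ₗ BettiUniverse.pull (fst ((A₀.X ⊗ A₁.X) ⊗ A₂.X) A₃.X ≫ snd (A₀.X ⊗ A₁.X) A₂.X) 1 =
        BettiUniverse.pull (fst ((A₀.X ⊗ A₁.X) ⊗ A₂.X) A₃.X ≫ snd (A₀.X ⊗ A₁.X) A₂.X) 1 ∘ₗ ι'₂ a) ∧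
      (∀ a : K, ι a ∘ₗ BettiUniverse.pull (snd ((A₀.X ⊗ A₁.X) ⊗ A₂.X) A₃.X) 1 =
        BettiUniverse.pull (snd ((A₀.X ⊗ A₁.X) ⊗ A₂.X) A₃.X) 1 ∘ₗ ι'₃ a) := by
  -- level `01`
  obtain ⟨b₀₁, -, -, hb₀₁⟩ := exists_eigenbasis_prod u₀ u₁ b₀ b₁ τ₀ τ₁ hb₀ hb₁
  obtain ⟨ι₀₁, h₀₁f, h₀₁s, hu₀₁⟩ := exists_ratAction_prod ι'₀ ι'₁ u₀ u₁ hu₀ hu₁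
  -- level `012`
  obtain ⟨b₀₁₂, -, -, hb₀₁₂⟩ := exists_eigenbasis_prod
    (fun b ↦ AbelianVariety.prodLift (AbelianVariety.fst A₀ A₁ ≫ u₀ b) (AbelianVariety.snd A₀ A₁ ≫ u₁ b)) u₂
    b₀₁ b₂ (Sum.elim τ₀ τ₁) τ₂ hb₀₁ hb₂
  obtain ⟨ι₀₁₂, h₀₁₂f, h₀₁₂s, hu₀₁₂⟩ := exists_ratAction_prod ι₀₁ ι'₂
    (fun b ↦ AbelianVariety.prodLift (AbelianVariety.fst A₀ A₁ ≫ u₀ b) (AbelianVariety.snd A₀ A₁ ≫ u₁ b)) u₂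
    hu₀₁ hu₂
  -- level `0123`
  obtain ⟨b, -, -, hb⟩ := exists_eigenbasis_prod
    (fun b ↦ AbelianVariety.prodLift (AbelianVariety.fst (A₀.prod A₁) A₂ ≫
      AbelianVariety.prodLift (AbelianVariety.fst A₀ A₁ ≫ u₀ b) (AbelianVariety.snd A₀ A₁ ≫ u₁ b))
      (AbelianVariety.snd (A₀.prod A₁) A₂ ≫ u₂ b)) u₃ b₀₁₂ b₃ (Sum.elim (Sum.elim τ₀ τ₁) τ₂) τ₃ hb₀₁₂ hb₃
  obtain ⟨ι, hf, hs, hu⟩ := exists_ratAction_prod ι₀₁₂ ι'₃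
    (fun b ↦ AbelianVariety.prodLift (AbelianVariety.fst (A₀.prod A₁) A₂ ≫
      AbelianVariety.prodLift (AbelianVariety.fst A₀ A₁ ≫ u₀ b) (AbelianVariety.snd A₀ A₁ ≫ u₁ b))
      (AbelianVariety.snd (A₀.prod A₁) A₂ ≫ u₂ b)) u₃ hu₀₁₂ hu₃
  refine ⟨_, b, _, ι, hb, hu, fun a ↦ ?_, fun a ↦ ?_, fun a ↦ ?_, hs⟩
  · -- `pr₀ = fst ≫ fst ≫ fst`
    refine LinearMap.ext fun x ↦ ?_
    have e1 := LinearMap.congr_fun (hf a)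
    have e2 := LinearMap.congr_fun (h₀₁₂f a)
    have e3 := LinearMap.congr_fun (h₀₁f a)
    simp only [LinearMap.comp_apply] at e1 e2 e3
    rw [BettiUniverse.pull_comp, BettiUniverse.pull_comp]
    simp only [LinearMap.comp_apply]
    change ι a (BettiUniverse.pull (AbelianVariety.fst ((A₀.prod A₁).prod A₂) A₃).hom.hom.hom 1
      (BettiUniverse.pull (AbelianVariety.fst (A₀.prod A₁) A₂).hom.hom.hom 1
        (BettiUniverse.pull (AbelianVariety.fst A₀ A₁).hom.hom.hom 1 x))) = _
    rw [e1, e2, e3]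
    rfl
  · -- `pr₁ = fst ≫ fst ≫ snd`
    refine LinearMap.ext fun x ↦ ?_
    have e1 := LinearMap.congr_fun (hf a)
    have e2 := LinearMap.congr_fun (h₀₁₂f a)
    have e3 := LinearMap.congr_fun (h₀₁s a)
    simp only [LinearMap.comp_apply] at e1 e2 e3
    rw [BettiUniverse.pull_comp, BettiUniverse.pull_comp]
    simp only [LinearMap.comp_apply]
    change ι a (BettiUniverse.pull (AbelianVariety.fst ((A₀.prod A₁).prod A₂) A₃).hom.hom.hom 1
      (BettiUniverse.pull (AbelianVariety.fst (A₀.prod A₁) A₂).hom.hom.hom 1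
        (BettiUniverse.pull (AbelianVariety.snd A₀ A₁).hom.hom.hom 1 x))) = _
    rw [e1, e2, e3]
    rfl
  · -- `pr₂ = fst ≫ snd`
    refine LinearMap.ext fun x ↦ ?_
    have e1 := LinearMap.congr_fun (hf a)
    have e2 := LinearMap.congr_fun (h₀₁₂s a)
    simp only [LinearMap.comp_apply] at e1 e2
    rw [BettiUniverse.pull_comp]
    simp only [LinearMap.comp_apply]
    change ι a (BettiUniverse.pull (AbelianVariety.fst ((A₀.prod A₁).prod A₂) A₃).hom.hom.hom 1
      (BettiUniverse.pull (AbelianVariety.snd (A₀.prod A₁) A₂).hom.hom.hom 1 x)) = _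
    rw [e1, e2]
    rfl

end Four

/-! ### §2 R2 on a four-fold product of abelian varieties with factorwise CM data -/

section Generic

variable {K : Type} [Field K] [NumberField K] [IsCMField K]

/-- **R2 on `B = ((A₀ × A₁) × A₂) × A₃` (abelian-variety spelling).**  Given on each factor endomorphisms
`uᵢ : 𝓞_K → End(Aᵢ)` diagonal on a basis of `H¹(Aᵢ(ℂ); ℂ)` (eigencharacters `τᵢ : ιᵢ → Hom(K, ℂ)`, `ιᵢ` non-empty
finite) and inducing `ℚ`-algebra actions `ι'ᵢ` on `H¹(Aᵢ(ℂ); ℚ)`, there is `θ ∈ H²(B(ℂ); ℚ)`, rational-algebraic,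
with `θ ⊗ 1` a non-zero real multiple of a Kähler class and `(θ ⊗ 1)^{dim B} ≠ 0`, such that for every `a ∈ K` and
all `ℚ`-linear `T, T'` on `H¹(B(ℂ); ℚ)` with `T ∘ prᵢ^* = prᵢ^* ∘ ι'ᵢ(a)`, `T' ∘ prᵢ^* = prᵢ^* ∘ ι'ᵢ(ā)` (composite
projections `pr₀ = fst ≫ fst ≫ fst`, …, `pr₃ = snd`): `B_θ(φ ∘ T, ψ) = B_θ(φ, ψ ∘ T')`,
`B_θ(φ, ψ) = alternatingMapToDual ℚ _ 2 ![φ, ψ] ω`, `wedgeToCup ω = θ`.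
[cite: Shimura1998, §6.2 Theorem 4 (3)] [cite: MilneCM2006, Ch. I Example 2.9 and Prop. 3.17]
[cite: Deligne1982HodgeCycles, §4 p. 47 and §5 p. 39] -/
theorem rosatiTheta_prod4 {ι₀ ι₁ ι₂ ι₃ : Type} [Fintype ι₀] [Fintype ι₁] [Fintype ι₂] [Fintype ι₃] [Nonempty ι₀]
    (A₀ A₁ A₂ A₃ : AbelianVariety ℂ)
    (u₀ : 𝓞 K → (A₀ ⟶ A₀)) (u₁ : 𝓞 K → (A₁ ⟶ A₁)) (u₂ : 𝓞 K → (A₂ ⟶ A₂)) (u₃ : 𝓞 K → (A₃ ⟶ A₃))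
    (b₀ : Module.Basis ι₀ ℂ (complexBetti A₀.X 1)) (b₁ : Module.Basis ι₁ ℂ (complexBetti A₁.X 1))
    (b₂ : Module.Basis ι₂ ℂ (complexBetti A₂.X 1)) (b₃ : Module.Basis ι₃ ℂ (complexBetti A₃.X 1))
    (τ₀ : ι₀ → (K →+* ℂ)) (τ₁ : ι₁ → (K →+* ℂ)) (τ₂ : ι₂ → (K →+* ℂ)) (τ₃ : ι₃ → (K →+* ℂ))
    (hb₀ : ∀ (a : 𝓞 K) i, complexBetti.map (u₀ a).hom.hom.hom 1 (b₀ i) = (τ₀ i (a : K)) • b₀ i)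
    (hb₁ : ∀ (a : 𝓞 K) i, complexBetti.map (u₁ a).hom.hom.hom 1 (b₁ i) = (τ₁ i (a : K)) • b₁ i)
    (hb₂ : ∀ (a : 𝓞 K) i, complexBetti.map (u₂ a).hom.hom.hom 1 (b₂ i) = (τ₂ i (a : K)) • b₂ i)
    (hb₃ : ∀ (a : 𝓞 K) i, complexBetti.map (u₃ a).hom.hom.hom 1 (b₃ i) = (τ₃ i (a : K)) • b₃ i)
    (ι'₀ : K →ₐ[ℚ] Module.End ℚ (bettiCohomology A₀.X 1)) (ι'₁ : K →ₐ[ℚ] Module.End ℚ (bettiCohomology A₁.X 1))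
    (ι'₂ : K →ₐ[ℚ] Module.End ℚ (bettiCohomology A₂.X 1)) (ι'₃ : K →ₐ[ℚ] Module.End ℚ (bettiCohomology A₃.X 1))
    (hu₀ : ∀ b : 𝓞 K, BettiUniverse.pull (u₀ b).hom.hom.hom 1 = ι'₀ (b : K))
    (hu₁ : ∀ b : 𝓞 K, BettiUniverse.pull (u₁ b).hom.hom.hom 1 = ι'₁ (b : K))
    (hu₂ : ∀ b : 𝓞 K, BettiUniverse.pull (u₂ b).hom.hom.hom 1 = ι'₂ (b : K))
    (hu₃ : ∀ b : 𝓞 K, BettiUniverse.pull (u₃ b).hom.hom.hom 1 = ι'₃ (b : K)) :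
    ∃ θ : bettiCohomology (((A₀.prod A₁).prod A₂).prod A₃).X 2,
      θ ∈ ratAlgebraicClasses (((A₀.prod A₁).prod A₂).prod A₃).X 1 ∧
      (∃ s : ℝ, s ≠ 0 ∧ IsKaehlerClass (((A₀.prod A₁).prod A₂).prod A₃).dim (((A₀.prod A₁).prod A₂).prod A₃).X
        ((s : ℂ) • ofRatClass _ 2 θ)) ∧
      cupPowTwo (ofRatClass _ 2 θ) (((A₀.prod A₁).prod A₂).prod A₃).dim ≠ 0 ∧
      ∀ ω : ⋀[ℚ]^2 (bettiCohomology (((A₀.X ⊗ A₁.X) ⊗ A₂.X) ⊗ A₃.X) 1), wedgeToCup ℚ _ 2 ω = θ →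
        ∀ (a : K) (T T' : bettiCohomology (((A₀.X ⊗ A₁.X) ⊗ A₂.X) ⊗ A₃.X) 1 →ₗ[ℚ]
            bettiCohomology (((A₀.X ⊗ A₁.X) ⊗ A₂.X) ⊗ A₃.X) 1),
        T ∘ₗ BettiUniverse.pull (fst ((A₀.X ⊗ A₁.X) ⊗ A₂.X) A₃.X ≫ (fst (A₀.X ⊗ A₁.X) A₂.X ≫ fst A₀.X A₁.X)) 1 =
          BettiUniverse.pull (fst ((A₀.X ⊗ A₁.X) ⊗ A₂.X) A₃.X ≫ (fst (A₀.X ⊗ A₁.X) A₂.X ≫ fst A₀.X A₁.X)) 1 ∘ₗ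
            ι'₀ a →
        T ∘ₗ BettiUniverse.pull (fst ((A₀.X ⊗ A₁.X) ⊗ A₂.X) A₃.X ≫ (fst (A₀.X ⊗ A₁.X) A₂.X ≫ snd A₀.X A₁.X)) 1 =
          BettiUniverse.pull (fst ((A₀.X ⊗ A₁.X) ⊗ A₂.X) A₃.X ≫ (fst (A₀.X ⊗ A₁.X) A₂.X ≫ snd A₀.X A₁.X)) 1 ∘ₗ
            ι'₁ a →
        T ∘ₗ BettiUniverse.pull (fst ((A₀.X ⊗ A₁.X) ⊗ A₂.X) A₃.X ≫ snd (A₀.X ⊗ A₁.X) A₂.X) 1 =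
          BettiUniverse.pull (fst ((A₀.X ⊗ A₁.X) ⊗ A₂.X) A₃.X ≫ snd (A₀.X ⊗ A₁.X) A₂.X) 1 ∘ₗ ι'₂ a →
        T ∘ₗ BettiUniverse.pull (snd ((A₀.X ⊗ A₁.X) ⊗ A₂.X) A₃.X) 1 =
          BettiUniverse.pull (snd ((A₀.X ⊗ A₁.X) ⊗ A₂.X) A₃.X) 1 ∘ₗ ι'₃ a →
        T' ∘ₗ BettiUniverse.pull (fst ((A₀.X ⊗ A₁.X) ⊗ A₂.X) A₃.X ≫ (fst (A₀.X ⊗ A₁.X) A₂.X ≫ fst A₀.X A₁.X)) 1 =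
          BettiUniverse.pull (fst ((A₀.X ⊗ A₁.X) ⊗ A₂.X) A₃.X ≫ (fst (A₀.X ⊗ A₁.X) A₂.X ≫ fst A₀.X A₁.X)) 1 ∘ₗ
            ι'₀ (IsCMField.complexConj K a) →
        T' ∘ₗ BettiUniverse.pull (fst ((A₀.X ⊗ A₁.X) ⊗ A₂.X) A₃.X ≫ (fst (A₀.X ⊗ A₁.X) A₂.X ≫ snd A₀.X A₁.X)) 1 =
          BettiUniverse.pull (fst ((A₀.X ⊗ A₁.X) ⊗ A₂.X) A₃.X ≫ (fst (A₀.X ⊗ A₁.X) A₂.X ≫ snd A₀.X A₁.X)) 1 ∘ₗ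
            ι'₁ (IsCMField.complexConj K a) →
        T' ∘ₗ BettiUniverse.pull (fst ((A₀.X ⊗ A₁.X) ⊗ A₂.X) A₃.X ≫ snd (A₀.X ⊗ A₁.X) A₂.X) 1 =
          BettiUniverse.pull (fst ((A₀.X ⊗ A₁.X) ⊗ A₂.X) A₃.X ≫ snd (A₀.X ⊗ A₁.X) A₂.X) 1 ∘ₗ
            ι'₂ (IsCMField.complexConj K a) →
        T' ∘ₗ BettiUniverse.pull (snd ((A₀.X ⊗ A₁.X) ⊗ A₂.X) A₃.X) 1 =
          BettiUniverse.pull (snd ((A₀.X ⊗ A₁.X) ⊗ A₂.X) A₃.X) 1 ∘ₗ ι'₃ (IsCMField.complexConj K a) →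
        ∀ φ ψ : Module.Dual ℚ (bettiCohomology (((A₀.X ⊗ A₁.X) ⊗ A₂.X) ⊗ A₃.X) 1),
          exteriorPower.alternatingMapToDual ℚ _ 2 ![φ ∘ₗ T, ψ] ω =
            exteriorPower.alternatingMapToDual ℚ _ 2 ![φ, ψ ∘ₗ T'] ω := by
  classical
  -- diagonal data on `B`
  obtain ⟨u, b, τ, ι, hb, hu, hp₀, hp₁, hp₂, hp₃⟩ := exists_diagData_prod4 A₀ A₁ A₂ A₃ u₀ u₁ u₂ u₃ b₀ b₁ b₂ b₃
    τ₀ τ₁ τ₂ τ₃ hb₀ hb₁ hb₂ hb₃ ι'₀ ι'₁ ι'₂ ι'₃ hu₀ hu₁ hu₂ hu₃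
  -- `0 < dim B`
  have hdim : 0 < (((A₀.prod A₁).prod A₂).prod A₃).dim := by
    have h1 := abelianVarietyCohomologyExteriorH1_holds.finrank_one (((A₀.prod A₁).prod A₂).prod A₃)
    rw [Module.finrank_eq_card_basis b] at h1
    have h3 := Fintype.card_pos (α := (((ι₀ ⊕ ι₁) ⊕ ι₂) ⊕ ι₃))
    omega
  -- the averaged hyperplane class of `B` (lit-milne, p232481)
  obtain ⟨θ, hθalg, hK, htop, hD, -⟩ := exists_rosati_ratClass_of_eigenbasis (u := u) hdim hb
  -- the `K`-balanced identity on rational `H²`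
  have hbal : ∀ b' : 𝓞 K, IsCMField.complexConj K b' = -(b' : K) →
      BettiUniverse.pull (𝟙 (((A₀.prod A₁).prod A₂).prod A₃) + u b').hom.hom.hom 2 θ =
        θ + BettiUniverse.pull (u b').hom.hom.hom 2 θ := by
    intro b' hb'
    apply ofRatClass_injective (Y := ComplexPoints (((A₀.prod A₁).prod A₂).prod A₃).X) 2
    rw [map_add, ofRatClass_pull, ofRatClass_pull]
    exact hD b' hb'
  -- dual-form Rosati for `ι` (file `RosatiDualForm`)
  have hros := bettiDual_rosati_of_balanced_endo (((A₀.prod A₁).prod A₂).prod A₃) ι u hu θ hbal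
  refine ⟨θ, hθalg, hK, htop, fun ω hω a T T' hT₀ hT₁ hT₂ hT₃ hT'₀ hT'₁ hT'₂ hT'₃ φ ψ ↦ ?_⟩
  -- the Künneth junction: `T = ι a`, `T' = ι ā`
  have hΨ := kunneth_one_bijective₄ (X₀ := A₀.X) (X₁ := A₁.X) (X₂ := A₂.X) (X₃ := A₃.X)
    AbelianVariety.isSmoothProjective_holds AbelianVariety.isSmoothProjective_holds
    AbelianVariety.isSmoothProjective_holds AbelianVariety.isSmoothProjective_holds
  have junction : ∀ (a' : K) (S : bettiCohomology (((A₀.X ⊗ A₁.X) ⊗ A₂.X) ⊗ A₃.X) 1 →ₗ[ℚ]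
      bettiCohomology (((A₀.X ⊗ A₁.X) ⊗ A₂.X) ⊗ A₃.X) 1),
      S ∘ₗ BettiUniverse.pull (fst ((A₀.X ⊗ A₁.X) ⊗ A₂.X) A₃.X ≫ (fst (A₀.X ⊗ A₁.X) A₂.X ≫ fst A₀.X A₁.X)) 1 =
        BettiUniverse.pull (fst ((A₀.X ⊗ A₁.X) ⊗ A₂.X) A₃.X ≫ (fst (A₀.X ⊗ A₁.X) A₂.X ≫ fst A₀.X A₁.X)) 1 ∘ₗ
          ι'₀ a' →
      S ∘ₗ BettiUniverse.pull (fst ((A₀.X ⊗ A₁.X) ⊗ A₂.X) A₃.X ≫ (fst (A₀.X ⊗ A₁.X) A₂.X ≫ snd A₀.X A₁.X)) 1 =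
        BettiUniverse.pull (fst ((A₀.X ⊗ A₁.X) ⊗ A₂.X) A₃.X ≫ (fst (A₀.X ⊗ A₁.X) A₂.X ≫ snd A₀.X A₁.X)) 1 ∘ₗ
          ι'₁ a' →
      S ∘ₗ BettiUniverse.pull (fst ((A₀.X ⊗ A₁.X) ⊗ A₂.X) A₃.X ≫ snd (A₀.X ⊗ A₁.X) A₂.X) 1 =
        BettiUniverse.pull (fst ((A₀.X ⊗ A₁.X) ⊗ A₂.X) A₃.X ≫ snd (A₀.X ⊗ A₁.X) A₂.X) 1 ∘ₗ ι'₂ a' →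
      S ∘ₗ BettiUniverse.pull (snd ((A₀.X ⊗ A₁.X) ⊗ A₂.X) A₃.X) 1 =
        BettiUniverse.pull (snd ((A₀.X ⊗ A₁.X) ⊗ A₂.X) A₃.X) 1 ∘ₗ ι'₃ a' →
      S = ι a' := by
    intro a' S h0 h1 h2 h3
    refine (LinearMap.cancel_right hΨ.2).1 ?_
    simp only [LinearMap.comp_coprod]
    rw [h0, h1, h2, h3, hp₀ a', hp₁ a', hp₂ a', hp₃ a']
  have hT : T = ι a := junction a T hT₀ hT₁ hT₂ hT₃
  have hT' : T' = ι (IsCMField.complexConj K a) := junction _ T' hT'₀ hT'₁ hT'₂ hT'₃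
  have hωθ : ω = ((hasExteriorCohomologyH1_rat (((A₀.prod A₁).prod A₂).prod A₃)).equiv 2).symm θ := by
    apply ((hasExteriorCohomologyH1_rat (((A₀.prod A₁).prod A₂).prod A₃)).equiv 2).injective
    rw [LinearEquiv.apply_symm_apply, HasExteriorCohomologyH1.equiv_apply]
    exact hω
  rw [hT, hT', hωθ]
  exact hros a φ ψ

end Generic

end Summit.HodgeConjecture.CorCM.Model

end
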